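import Summits.HodgeConjecture.CorCM.ReflexTwinSlot
import Summits.HodgeConjecture.CorCM.PairFlipSexticReflexSlotRank
import HarnessLib

/-!
# A pair-flip CM type with three conjugate pairs against a type of the TWIN of its reflex slot: the rank is ADDITIVE

COR-CM (cell `pub-hodgecm2`, binder seat `b16` gen 45, count-neutral claim REFLEX-OCTIC-34 part II, file T3); theorems
only, no definition, no named fact, no `sorry`.  Two-slot family `Σ` on `E_{i₀} ⊔ E_{i₁}` (abstract setting of
`Literature/NumberTheory/ComplexMultiplication/CMTypeRankFamilies`, `U(·) = antiSpan`, `rank = dim U + 1`), where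
`E_{i₀} = Z` is the pair-flip slot (`Φ_{i₀} = {x₁, x₂, x₃}`, flips `φ₁, φ₂, φ₃`, a pure transposition `t`, `G`
transitive) and `E_{i₁} = Y'` is the TWIN of the reflex slot `Y` of `Φ_{i₀}` (`ReflexTwinSlot`: `πM : Y' → X = Y/ρ`,
`πk : Y' → X_k = {κ₀, ρκ₀}`, `tκ₀ ≠ κ₀`) — the embeddings of the OTHER octic CM field `K' = M·k` inside the Galois
closure of a sextic CM field with group `ℤ₂ × 𝔖₄` (`M` the maximal real subfield of the reflex field `K*`, `k` the
imaginary quadratic subfield of the closure not contained in `K*`).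

> **Theorem** (`hpair_of_twin`, `typeRank_sigmaType_add_card_eq_of_twin`, `typeRank_sigmaType_eq_iff_of_twin`).  For
> EVERY CM type `Ψ' = Φ_{i₁}` of the twin slot the pair `(Φ_{i₀}, Ψ')` has NO COMMON CONSTITUENT
> (`CMTypeRankCommonConstituent`): `U(Σ) = U(Φ_{i₀}) ⊕ U(Ψ')`, `rank(Σ) − 1 = (rank Φ_{i₀} − 1) + (rank Ψ' − 1)` —
> on Hodge groups `Hg(T × F') = Hg(T) × Hg(F')` — and `Σ` is nondegenerate iff `Ψ'` is.

PROOF.  `U(Φ_{i₀}) = Anti(Z)` is irreducible (pair flips), so a common constituent would be an equivariant injection of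
`Anti(Z)` into the odd weights on `Y'`, or an equivariant injection of a stable `P ≤ U(Ψ')` ONTO `Anti(Z)`.  Either way
the vector `e₃ = δ_{x₃} − δ_{ρx₃}` — fixed by `g₄ = tφ₂` and negated by `h = tφ₃` — corresponds to an odd weight `f` on
`Y'` with `f∘g₄ = f`, `f∘h = −f`, which vanishes by `ReflexTwinSlot.eq_zero_of_odd_of_twin`; so `e₃ = 0`, absurd.
(Representation-theoretically: `Anti(Z) ≅ det ⊗ (std ⊗ sgn)` and `Anti(Y') ≅ det ⊗ (1 ⊕ std)` as `ℤ₂ × 𝔖₄`-modules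
share no constituent.)  Contrast: against the reflex slot `Y` itself (`Anti(Y) ≅ (std ⊗ sgn... ) ⊕ χ` contains `Anti(Z)`)
the rank collapses on the Hamming balls (`PairFlipSexticReflexSlotBalls`).

## References

* [Dodson1984] B. Dodson, *The structure of Galois groups of CM-fields*, Trans. AMS 283 (1984), §5.1.2, Prop. 5.2.2,
  §3.3.2.
* [Gordon1999HodgeAVSurvey] B. B. Gordon, *A survey of the Hodge conjecture for abelian varieties*, §3 Theorem
  (proof), 7.5–7.7.
* [MoonenZarhin1999LowDim] B. Moonen, Yu. Zarhin, *Hodge classes on abelian varieties of low dimension*, Math. Ann.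
  315 (1999).
-/

set_option autoImplicit false

noncomputable section

open scoped BigOperators Classical

namespace Summit.HodgeConjecture.CorCM

namespace ReflexSlot

open Literature.NumberTheory.ComplexMultiplication

variable {G : Type*} [Group G] {I : Type*} {E : I → Type*} [∀ i, MulAction G (E i)] [∀ i, Fintype (E i)]
  {Y X Xk : Type*} [MulAction G Y] [MulAction G X] [MulAction G Xk] [Fintype Y]
  {ρ : G} {Φ : ∀ i, Set (E i)} {i₀ i₁ : I} {T : Y → Set (E i₀)} {y₀ : Y} {x₁ x₂ x₃ : E i₀}
  {φ₁ φ₂ φ₃ t : G} {qM : Y → X} {πM : E i₁ → X} {πk : E i₁ → Xk} {κ₀ : Xk}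

omit [∀ i, Fintype (E i)] [Fintype Y] in
/-- `e₃ = δ_{x₃} − δ_{ρx₃}` is fixed by `g₄ = tφ₂` and negated by `h = tφ₃`. [cite: Dodson1984, §5.1.2] -/
theorem single_sub_single_comp_twist (hΦ : IsCMTypeWith ρ (Φ i₀)) (hx : Φ i₀ = {x₁, x₂, x₃})
    (h23 : x₂ ≠ x₃) (hφ₂ : φ₂ • x₂ = ρ • x₂ ∧ ∀ z : E i₀, z ≠ x₂ → z ≠ ρ • x₂ → φ₂ • z = z)
    (hφ₃ : φ₃ • x₃ = ρ • x₃ ∧ ∀ z : E i₀, z ≠ x₃ → z ≠ ρ • x₃ → φ₃ • z = z)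
    (ht : t • x₁ = x₂ ∧ t • x₂ = x₁ ∧ t • x₃ = x₃) :
    (fun z => (Pi.single x₃ (1 : ℚ) - Pi.single (ρ • x₃) 1 : E i₀ → ℚ) ((t * φ₂) • z)) =
        (Pi.single x₃ (1 : ℚ) - Pi.single (ρ • x₃) 1 : E i₀ → ℚ) ∧
      (fun z => (Pi.single x₃ (1 : ℚ) - Pi.single (ρ • x₃) 1 : E i₀ → ℚ) ((t * φ₃) • z)) =
        -(Pi.single x₃ (1 : ℚ) - Pi.single (ρ • x₃) 1 : E i₀ → ℚ) := by
  obtain ⟨m₁, m₂, m₃⟩ := mem_of_eq_triple hx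
  have i₃ : (t * φ₂)⁻¹ • x₃ = x₃ := by
    rw [inv_smul_eq_iff, mul_smul, (pairFlip_smul_eq_of_mem hΦ m₂ m₃ h23.symm hφ₂.2).1, ht.2.2]
  have j₃ : (t * φ₃)⁻¹ • x₃ = ρ • x₃ := by
    rw [inv_smul_eq_iff, mul_smul, smul_rho_eq_of_pairFlip hΦ hφ₃.1, ht.2.2]
  refine ⟨by rw [single_sub_single_comp_smul hΦ.comm x₃ (t * φ₂), i₃], ?_⟩
  rw [single_sub_single_comp_smul hΦ.comm x₃ (t * φ₃), j₃, hΦ.invol, neg_sub]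

/-- **No common constituent between the pair-flip slot and the twin slot** — the pairwise hypothesis `hpair` of
`CMTypeRankCommonConstituent.map_slotExt_antiSpan_le_of_pairwise` for the two-slot family `{i₀, i₁}`.
[cite: Gordon1999HodgeAVSurvey, §3 Theorem (proof)] [cite: Dodson1984, §5.1.2 and Prop. 5.2.2] -/
theorem hpair_of_twin [MulAction.IsPretransitive G (E i₀)] (h : ∀ i, IsCMTypeWith ρ (Φ i)) (h01 : i₀ ≠ i₁)
    (hI : ∀ k, k = i₀ ∨ k = i₁)
    (hT : ∀ (g : G) (y : Y) (x : E i₀), x ∈ T (g • y) ↔ g⁻¹ • x ∈ T y) (hTi : Function.Injective T)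
    (hT₀ : T y₀ = Φ i₀) (hY : ∀ y : Y, ∃ g : G, g • y₀ = y) (hx : Φ i₀ = {x₁, x₂, x₃}) (h12 : x₁ ≠ x₂)
    (h13 : x₁ ≠ x₃) (h23 : x₂ ≠ x₃)
    (hφ₁ : φ₁ • x₁ = ρ • x₁ ∧ ∀ z : E i₀, z ≠ x₁ → z ≠ ρ • x₁ → φ₁ • z = z)
    (hφ₂ : φ₂ • x₂ = ρ • x₂ ∧ ∀ z : E i₀, z ≠ x₂ → z ≠ ρ • x₂ → φ₂ • z = z)
    (hφ₃ : φ₃ • x₃ = ρ • x₃ ∧ ∀ z : E i₀, z ≠ x₃ → z ≠ ρ • x₃ → φ₃ • z = z)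
    (ht : t • x₁ = x₂ ∧ t • x₂ = x₁ ∧ t • x₃ = x₃)
    (hqM : ∀ (g : G) (y : Y), qM (g • y) = g • qM y) (hqMρ : ∀ y : Y, qM (ρ • y) = qM y)
    (hqMs : Function.Surjective qM) (hπM : ∀ (g : G) (y' : E i₁), πM (g • y') = g • πM y')
    (hπMs : Function.Surjective πM) (hπk : ∀ (g : G) (y' : E i₁), πk (g • y') = g • πk y')
    (hfib : ∀ y' y'' : E i₁, πM y' = πM y'' → y'' = y' ∨ y'' = ρ • y')
    (hfac : ∀ g g' : G, (∀ z : E i₀, g • z = g' • z) → ∀ κ : Xk, g • κ = g' • κ)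
    (hXk : ∀ κ : Xk, κ = κ₀ ∨ κ = ρ • κ₀) (hκ : ρ • κ₀ ≠ κ₀) (htκ : t • κ₀ ≠ κ₀) :
    ∀ i j, i ≠ j → ∀ P : Submodule ℚ (E i → ℚ), P ≤ antiSpan G (Φ i) →
      (∀ g : G, ∀ f ∈ P, (fun x => f (g • x)) ∈ P) →
      ∀ TT : (E i → ℚ) →ₗ[ℚ] (E j → ℚ),
        (∀ g : G, ∀ f ∈ P, TT (fun x => f (g • x)) = fun y => TT f (g • y)) →
        (∀ f ∈ P, TT f ∈ antiSpan G (Φ j)) → (∀ f ∈ P, TT f = 0 → f = 0) → P = ⊥ := by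
  -- the core: an odd weight on `Y'` fixed by `g₄` and negated by `h` vanishes
  have core : ∀ f : E i₁ → ℚ, (∀ y', f (ρ • y') = -f y') → (∀ y', f ((t * φ₂) • y') = f y') →
      (∀ y', f ((t * φ₃) • y') = -f y') → f = 0 := fun f hodd h4 hh =>
    eq_zero_of_odd_of_twin (h i₀) hT hTi hT₀ hY hx h12 h13 h23 hφ₁ hφ₂ hφ₃ ht hqM hqMρ hqMs hπM hπMs hπk hfib hfac
      hXk hκ htκ hodd h4 hh
  obtain ⟨g4, gh⟩ := single_sub_single_comp_twist (h i₀) hx h23 hφ₂ hφ₃ ht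
  set e₃ : E i₀ → ℚ := Pi.single x₃ (1 : ℚ) - Pi.single (ρ • x₃) 1 with he₃
  have he₃0 : e₃ ≠ 0 := single_sub_single_ne_zero (h i₀) x₃
  have hflip := forall_exists_pairFlip_of_triple (h i₀) hx hφ₁ hφ₂ hφ₃
  intro i j hij P hP hst TT hTT hTj hinj
  by_contra hP0
  rcases hI i with rfl | rfl <;> rcases hI j with rfl | rfl
  · exact hij rfl
  · -- `i = i₀`, `j = i₁`: `P = Anti(Z) ∋ e₃`, `f = TT e₃`
    have hPeq : P = antiWeights (E := E i) ρ :=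
      eq_antiWeights_of_stable_of_pairFlip (h i).invol (h i).comm (h i).rho_smul_ne hflip
        (hP.trans (antiSpan_le_antiWeights' (h i))) hP0 (fun g f hf => hst g f hf)
    have he₃P : e₃ ∈ P := by rw [hPeq]; exact single_sub_single_mem_antiWeights (h i).invol x₃
    have hf0 : TT e₃ = 0 := by
      refine core (TT e₃) (fun y' => mem_antiWeights_iff'.1 (antiSpan_le_antiWeights' (h j) (hTj e₃ he₃P)) y')
        (fun y' => ?_) (fun y' => ?_)
      · have h1 := hTT (t * φ₂) e₃ he₃P
        rw [g4] at h1
        exact (congrFun h1 y').symm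
      · have h1 := hTT (t * φ₃) e₃ he₃P
        rw [gh, map_neg] at h1
        have h2 := congrFun h1 y'
        rw [Pi.neg_apply] at h2
        linarith
    exact he₃0 (hinj e₃ he₃P hf0)
  · -- `i = i₁`, `j = i₀`: `TT(P) = Anti(Z) ∋ e₃ = TT f`
    set W : Submodule ℚ (E j → ℚ) := P.map TT with hW
    have hWeq : W = antiWeights (E := E j) ρ := by
      refine eq_antiWeights_of_stable_of_pairFlip (h j).invol (h j).comm (h j).rho_smul_ne hflip ?_ ?_ ?_
      · rintro _ ⟨f, hf, rfl⟩
        exact antiSpan_le_antiWeights' (h j) (hTj f hf)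
      · obtain ⟨f, hfP, hf0⟩ := (Submodule.ne_bot_iff P).1 hP0
        rw [Submodule.ne_bot_iff]
        exact ⟨TT f, ⟨f, hfP, rfl⟩, fun h0 => hf0 (hinj f hfP h0)⟩
      · rintro g _ ⟨f, hf, rfl⟩
        exact ⟨_, hst g f hf, hTT g f hf⟩
    obtain ⟨f, hfP, hfe⟩ : ∃ f ∈ P, TT f = e₃ := by
      have : e₃ ∈ W := by rw [hWeq]; exact single_sub_single_mem_antiWeights (h j).invol x₃
      obtain ⟨f, hf, hfe⟩ := this
      exact ⟨f, hf, hfe⟩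
    have hodd : ∀ y', f (ρ • y') = -f y' := fun y' =>
      mem_antiWeights_iff'.1 (hP.trans (antiSpan_le_antiWeights' (h i)) hfP) y'
    have h4 : ∀ y', f ((t * φ₂) • y') = f y' := by
      intro y'
      have hmem : (fun x => f ((t * φ₂) • x)) - f ∈ P := P.sub_mem (hst _ f hfP) hfP
      have h0 : TT ((fun x => f ((t * φ₂) • x)) - f) = 0 := by
        rw [map_sub, hTT _ f hfP, hfe, g4, sub_self]
      have := congrFun (hinj _ hmem h0) y'
      simpa [sub_eq_zero] using this
    have hh : ∀ y', f ((t * φ₃) • y') = -f y' := by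
      intro y'
      have hmem : (fun x => f ((t * φ₃) • x)) + f ∈ P := P.add_mem (hst _ f hfP) hfP
      have h0 : TT ((fun x => f ((t * φ₃) • x)) + f) = 0 := by
        rw [map_add, hTT _ f hfP, hfe, gh, neg_add_cancel]
      have := congrFun (hinj _ hmem h0) y'
      simp only [Pi.add_apply, Pi.zero_apply] at this
      linarith
    have hf0 : f = 0 := core f hodd h4 hh
    rw [hf0, map_zero] at hfe
    exact he₃0 hfe.symm
  · exact hij rfl

variable [Fintype I] [∀ i, Nonempty (E i)]

/-- **Rank additivity for the twin**: `rank(Σ) + 2 = rank(Φ_{i₀}) + rank(Ψ') + 1` (`Hg(T × F') = Hg(T) × Hg(F')`).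
[cite: Gordon1999HodgeAVSurvey, §3 Theorem (1), 7.5] [cite: Dodson1984, §5.1.2] -/
theorem typeRank_sigmaType_add_card_eq_of_twin [MulAction.IsPretransitive G (E i₀)] (h : ∀ i, IsCMTypeWith ρ (Φ i))
    (h01 : i₀ ≠ i₁) (hI : ∀ k, k = i₀ ∨ k = i₁)
    (hT : ∀ (g : G) (y : Y) (x : E i₀), x ∈ T (g • y) ↔ g⁻¹ • x ∈ T y) (hTi : Function.Injective T)
    (hT₀ : T y₀ = Φ i₀) (hY : ∀ y : Y, ∃ g : G, g • y₀ = y) (hx : Φ i₀ = {x₁, x₂, x₃}) (h12 : x₁ ≠ x₂)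
    (h13 : x₁ ≠ x₃) (h23 : x₂ ≠ x₃)
    (hφ₁ : φ₁ • x₁ = ρ • x₁ ∧ ∀ z : E i₀, z ≠ x₁ → z ≠ ρ • x₁ → φ₁ • z = z)
    (hφ₂ : φ₂ • x₂ = ρ • x₂ ∧ ∀ z : E i₀, z ≠ x₂ → z ≠ ρ • x₂ → φ₂ • z = z)
    (hφ₃ : φ₃ • x₃ = ρ • x₃ ∧ ∀ z : E i₀, z ≠ x₃ → z ≠ ρ • x₃ → φ₃ • z = z)
    (ht : t • x₁ = x₂ ∧ t • x₂ = x₁ ∧ t • x₃ = x₃)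
    (hqM : ∀ (g : G) (y : Y), qM (g • y) = g • qM y) (hqMρ : ∀ y : Y, qM (ρ • y) = qM y)
    (hqMs : Function.Surjective qM) (hπM : ∀ (g : G) (y' : E i₁), πM (g • y') = g • πM y')
    (hπMs : Function.Surjective πM) (hπk : ∀ (g : G) (y' : E i₁), πk (g • y') = g • πk y')
    (hfib : ∀ y' y'' : E i₁, πM y' = πM y'' → y'' = y' ∨ y'' = ρ • y')
    (hfac : ∀ g g' : G, (∀ z : E i₀, g • z = g' • z) → ∀ κ : Xk, g • κ = g' • κ)
    (hXk : ∀ κ : Xk, κ = κ₀ ∨ κ = ρ • κ₀) (hκ : ρ • κ₀ ≠ κ₀) (htκ : t • κ₀ ≠ κ₀) :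
    typeRank G (sigmaType Φ) + Fintype.card I = (∑ i, typeRank G (Φ i)) + 1 :=
  haveI : Nonempty I := ⟨i₀⟩
  typeRank_sigmaType_add_card_eq_of_pairwise h (hpair_of_twin h h01 hI hT hTi hT₀ hY hx h12 h13 h23 hφ₁ hφ₂ hφ₃ ht
    hqM hqMρ hqMs hπM hπMs hπk hfib hfac hXk hκ htκ)

/-- **The twin family is nondegenerate iff the twin type `Ψ'` is** (every type of the pair-flip slot being
nondegenerate). [cite: Gordon1999HodgeAVSurvey, 7.5] [cite: Dodson1984, §3.3.2] -/
theorem typeRank_sigmaType_eq_iff_of_twin [MulAction.IsPretransitive G (E i₀)] (h : ∀ i, IsCMTypeWith ρ (Φ i))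
    (h01 : i₀ ≠ i₁) (hI : ∀ k, k = i₀ ∨ k = i₁)
    (hT : ∀ (g : G) (y : Y) (x : E i₀), x ∈ T (g • y) ↔ g⁻¹ • x ∈ T y) (hTi : Function.Injective T)
    (hT₀ : T y₀ = Φ i₀) (hY : ∀ y : Y, ∃ g : G, g • y₀ = y) (hx : Φ i₀ = {x₁, x₂, x₃}) (h12 : x₁ ≠ x₂)
    (h13 : x₁ ≠ x₃) (h23 : x₂ ≠ x₃)
    (hφ₁ : φ₁ • x₁ = ρ • x₁ ∧ ∀ z : E i₀, z ≠ x₁ → z ≠ ρ • x₁ → φ₁ • z = z)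
    (hφ₂ : φ₂ • x₂ = ρ • x₂ ∧ ∀ z : E i₀, z ≠ x₂ → z ≠ ρ • x₂ → φ₂ • z = z)
    (hφ₃ : φ₃ • x₃ = ρ • x₃ ∧ ∀ z : E i₀, z ≠ x₃ → z ≠ ρ • x₃ → φ₃ • z = z)
    (ht : t • x₁ = x₂ ∧ t • x₂ = x₁ ∧ t • x₃ = x₃)
    (hqM : ∀ (g : G) (y : Y), qM (g • y) = g • qM y) (hqMρ : ∀ y : Y, qM (ρ • y) = qM y)
    (hqMs : Function.Surjective qM) (hπM : ∀ (g : G) (y' : E i₁), πM (g • y') = g • πM y')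
    (hπMs : Function.Surjective πM) (hπk : ∀ (g : G) (y' : E i₁), πk (g • y') = g • πk y')
    (hfib : ∀ y' y'' : E i₁, πM y' = πM y'' → y'' = y' ∨ y'' = ρ • y')
    (hfac : ∀ g g' : G, (∀ z : E i₀, g • z = g' • z) → ∀ κ : Xk, g • κ = g' • κ)
    (hXk : ∀ κ : Xk, κ = κ₀ ∨ κ = ρ • κ₀) (hκ : ρ • κ₀ ≠ κ₀) (htκ : t • κ₀ ≠ κ₀) :
    typeRank G (sigmaType Φ) = Fintype.card (Σ k, E k) / 2 + 1 ↔
      typeRank G (Φ i₁) = Fintype.card (E i₁) / 2 + 1 := by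
  haveI : Nonempty I := ⟨i₀⟩
  rw [typeRank_sigmaType_eq_iff_forall_of_pairwise h (hpair_of_twin h h01 hI hT hTi hT₀ hY hx h12 h13 h23 hφ₁ hφ₂
    hφ₃ ht hqM hqMρ hqMs hπM hπMs hπk hfib hfac hXk hκ htκ)]
  have h0 := typeRank_eq_of_pairFlip (h i₀) (forall_exists_pairFlip_of_triple (h i₀) hx hφ₁ hφ₂ hφ₃)
  constructor
  · exact fun hall => hall i₁
  · intro h1 i
    rcases hI i with rfl | rfl
    · exact h0
    · exact h1

end ReflexSlot

end Summit.HodgeConjecture.CorCM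

end
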